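import Summits.HodgeConjecture.CorCM.TwoGroupUniqueInvolution
import Summits.HodgeConjecture.CorCM.GaloisNonNormalPrimeOrder
import Summits.HodgeConjecture.CorCM.CyclicTwoPowerCMTypes
import Summits.HodgeConjecture.CorCM.GaloisDicyclicNondegenerate
import HarnessLib

/-!
# MINIMAL Galois CM fields of `2`-power degree: GOOD ⟺ the Galois group is CYCLIC or GENERALISED QUATERNION

COR-CM (cell `pub-hodgecm2`), binder seat b04 (gen 34), count-neutral own lane «Galois-CM-type classification».  KERNEL ONLY:
theorems; no definition, no named fact, no `sorry`.  `HC_CM` is neither used nor claimed.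

A Galois CM field `K` is MINIMAL if it has no proper Galois CM subfield, i.e. every normal subgroup `N ≠ 1` of `Gal(K/ℚ)` contains
complex conjugation `c` (then `K^N` is totally real); for a `2`-group this says that `c` is the ONLY central involution.  By gen 32's
monotonicity (`CorCM/GaloisDegenerateMonotone`: GOOD descends to every Galois CM subfield) the minimal Galois CM fields are where
the classification of GOOD fields bottoms out.  THIS FILE CLASSIFIES THE MINIMAL GALOIS CM FIELDS OF `2`-POWER DEGREE `2^n ≥ 64`:

  **GOOD (every primitive CM type nondegenerate) ⟺ `Gal(K/ℚ)` is cyclic or generalised quaternion `Q_{2^n}`,**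

and in that case EVERY CM type of `K` is nondegenerate and the Hodge conjecture holds for every power of every abelian variety
with CM by `K`.  Proof of ⟹: in a GOOD Galois CM field of degree `≥ 52` all involutions of the Galois group are central (gen 33,
`GaloisModels.commute_of_involution_of_forall_isNondegenerate_of_le`, by the skew-section count of gen 32); minimality makes `c`
the unique involution; a `2`-group with a unique involution is cyclic or generalised quaternion
(`CorCM/TwoGroupUniqueInvolution`, gen 34, [Rotman1995, Thm. 5.46]).  ⟸: `CorCM/CyclicTwoPowerCMTypes.isNondegenerate_of_isCyclic`
(gen 11) and `CorCM/GaloisDicyclicNondegenerate.isNondegenerate_quaternion` (gen 20).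

* `eq_complexConj_of_involution_of_forall_isNondegenerate` — GOOD, `[K:ℚ] = 2^n ≥ 64`, `c` the only central involution ⟹ `c` is
  the only involution of `Gal(K/ℚ)`.
* `isCyclic_or_quaternion_of_forall_isNondegenerate` — **⟹**; `isNondegenerate_of_isCyclic_or_quaternion` — **⟸** (all types);
  `forall_isPrimitive_isNondegenerate_iff_isCyclic_or_quaternion` — **THE IFF**; `isNondegenerate_of_forall_isPrimitive_isNondegenerate`
  — GOOD ⟹ ALL CM types nondegenerate; `hodgeConjectureFor_pow_of_forall_isPrimitive_isNondegenerate` — ⟹ HC for all powers of all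
  abelian varieties with CM by `K`.
* `…_of_minimal` forms (`§3`): the same with minimality stated as «every normal subgroup `≠ 1` of `Gal(K/ℚ)` contains `c`»;
  `…_of_isCyclic_center`: the same for Galois groups with CYCLIC CENTRE; `…_of_forall_intermediateField`: the same with «no proper
  Galois CM subfield» stated on intermediate fields (every proper subfield normal over `ℚ` is fixed pointwise by complex conjugation).
* `§4` (general degree): `false_of_minimal_of_forall_isNondegenerate_of_prime` — a GOOD minimal field has NO odd prime `p ∣ [K:ℚ]`
  in the range of gen 33's count (`[K:ℚ] = 2pn`, `16 ≤ n`, `8p ≤ 2^(n/4)`; for `p = 3`: `[K:ℚ] ≥ 84`,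
  `not_three_dvd_finrank_of_minimal_of_forall_isNondegenerate`), since an element of order `p` would generate a NORMAL subgroup
  (GOOD) cutting out a proper Galois CM subfield; hence `exists_finrank_eq_two_pow_and_isCyclic_or_quaternion_of_minimal`:
  **large GOOD minimal Galois CM fields have `2`-power degree and cyclic or generalised quaternion Galois group.**
«GOOD» = `B = D` on all powers of all simple CM abelian varieties with CM by `K`; «BAD» = an exceptional Hodge class on a power of a
simple CM abelian variety (algebraicity open).  Below `2^n = 64` the statement is still true by the censuses of gens 17/28 (orders
`16`, `32`) but not uniformly provable by the skew-section count.

## References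

* [Rotman1995] J. J. Rotman, *An Introduction to the Theory of Groups*, 4th ed., GTM 148, Springer 1995, Thm. 5.46.
* [Shimura1998] G. Shimura, *Abelian Varieties with Complex Multiplication and Modular Functions*, §8.2 Prop. 26, §18.2.
* [Kubota1965] T. Kubota, *On the field extension by complex multiplication*, Trans. AMS 118 (1965), §4 Lemma 2.
* [Gordon1999HodgeAVSurvey] B. B. Gordon, *A survey of the Hodge conjecture for abelian varieties*, Thm. 6.4, §9.3.
-/

noncomputable section

open CategoryTheory CategoryTheory.Limits NumberField
open scoped BigOperators

namespace Summit.HodgeConjecture.CorCM.GaloisModels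

open Literature.NumberTheory.ComplexMultiplication
open Literature.AlgebraicGeometry.Motives (AbelianVariety CMType)
open Literature.AlgebraicGeometry.HodgeTheory
open Literature.AlgebraicGeometry.ComplexMultiplication (IsCMTypeRealisation)
open Literature.AlgebraicGeometry.Pohlmann1968
open Summit.HodgeConjecture.CorCM.GaloisRank

variable {K : Type} [Field K] [NumberField K] [IsCMField K] [IsGalois ℚ K]

/-! ## §1 GOOD and minimal ⟹ complex conjugation is the unique involution -/

/-- **In a GOOD Galois CM field of degree `2^n ≥ 64` whose only CENTRAL involution is complex conjugation, complex conjugation is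
the ONLY involution of `Gal(K/ℚ)`** (all involutions are central in a GOOD field of degree `≥ 52`).
[cite: Shimura1998, §8.2 Prop. 26] -/
theorem eq_complexConj_of_involution_of_forall_isNondegenerate {n : ℕ} (hdeg : Module.finrank ℚ K = 2 ^ n) (hn : 6 ≤ n)
    (hmin : ∀ σ : K ≃ₐ[ℚ] K, σ * σ = 1 → σ ≠ 1 → (∀ τ : K ≃ₐ[ℚ] K, τ * σ = σ * τ) →
      σ = (IsCMField.complexConj K).restrictScalars ℚ)
    (hgood : ∀ (Φ : CMType K) (φ : K →+* ℂ), IsPrimitive (ℂ ≃+* ℂ) Φ.1 φ → IsNondegenerate Φ)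
    (σ : K ≃ₐ[ℚ] K) (hσ : σ * σ = 1) (hσ1 : σ ≠ 1) : σ = (IsCMField.complexConj K).restrictScalars ℚ := by
  have h52 : 52 ≤ Module.finrank ℚ K := by
    rw [hdeg]
    calc (52 : ℕ) ≤ 2 ^ 6 := by norm_num
      _ ≤ 2 ^ n := Nat.pow_le_pow_right (by norm_num) hn
  exact hmin σ hσ hσ1 fun τ => commute_of_involution_of_forall_isNondegenerate_of_le h52 hgood σ hσ τ

/-- Hence any two involutions of `Gal(K/ℚ)` coincide. [cite: Shimura1998, §8.2 Prop. 26] -/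
theorem involution_eq_of_forall_isNondegenerate {n : ℕ} (hdeg : Module.finrank ℚ K = 2 ^ n) (hn : 6 ≤ n)
    (hmin : ∀ σ : K ≃ₐ[ℚ] K, σ * σ = 1 → σ ≠ 1 → (∀ τ : K ≃ₐ[ℚ] K, τ * σ = σ * τ) →
      σ = (IsCMField.complexConj K).restrictScalars ℚ)
    (hgood : ∀ (Φ : CMType K) (φ : K →+* ℂ), IsPrimitive (ℂ ≃+* ℂ) Φ.1 φ → IsNondegenerate Φ)
    (s t : K ≃ₐ[ℚ] K) (hs : s * s = 1) (hs1 : s ≠ 1) (ht : t * t = 1) (ht1 : t ≠ 1) : s = t := by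
  rw [eq_complexConj_of_involution_of_forall_isNondegenerate hdeg hn hmin hgood s hs hs1,
    eq_complexConj_of_involution_of_forall_isNondegenerate hdeg hn hmin hgood t ht ht1]

/-! ## §2 The classification -/

/-- **GOOD MINIMAL GALOIS CM FIELDS OF `2`-POWER DEGREE `2^n ≥ 64` HAVE CYCLIC OR GENERALISED QUATERNION GALOIS GROUP.**
`K` Galois CM with `[K:ℚ] = 2^n`, `n ≥ 6`, complex conjugation the only central involution of `Gal(K/ℚ)` (no proper Galois CM
subfield); if every primitive CM type of `K` is nondegenerate, then `Gal(K/ℚ)` is cyclic or `Gal(K/ℚ) ≃* QuaternionGroup (2^(n-2))`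
(generalised quaternion of order `2^n`). [cite: Rotman1995, Thm. 5.46] [cite: Shimura1998, §8.2 Prop. 26] -/
theorem isCyclic_or_quaternion_of_forall_isNondegenerate {n : ℕ} (hdeg : Module.finrank ℚ K = 2 ^ n) (hn : 6 ≤ n)
    (hmin : ∀ σ : K ≃ₐ[ℚ] K, σ * σ = 1 → σ ≠ 1 → (∀ τ : K ≃ₐ[ℚ] K, τ * σ = σ * τ) →
      σ = (IsCMField.complexConj K).restrictScalars ℚ)
    (hgood : ∀ (Φ : CMType K) (φ : K →+* ℂ), IsPrimitive (ℂ ≃+* ℂ) Φ.1 φ → IsNondegenerate Φ) :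
    IsCyclic (K ≃ₐ[ℚ] K) ∨ Nonempty ((K ≃ₐ[ℚ] K) ≃* QuaternionGroup (2 ^ (n - 2))) := by
  classical
  have hcard : Nat.card (K ≃ₐ[ℚ] K) = 2 ^ n := by
    rw [Nat.card_eq_fintype_card, card_model_eq_finrank (MulEquiv.refl (K ≃ₐ[ℚ] K)), hdeg]
  rcases UniqueInvolution.isCyclic_or_nonempty_mulEquiv_quaternionGroup hcard
      (involution_eq_of_forall_isNondegenerate hdeg hn hmin hgood) with h | ⟨-, h⟩
  · exact Or.inl h
  · exact Or.inr h

/-- **Conversely, cyclic or generalised quaternion Galois group of order `2^n` ⟹ EVERY CM type of `K` is nondegenerate** (no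
primitivity, minimality or size hypothesis; gen 11 `CyclicTwoPowerCMTypes`, gen 20 `GaloisDicyclicNondegenerate`).
[cite: Kubota1965, §4 Lemma 2] -/
theorem isNondegenerate_of_isCyclic_or_quaternion {n : ℕ} (hdeg : Module.finrank ℚ K = 2 ^ n) (hn : 1 ≤ n)
    (h : IsCyclic (K ≃ₐ[ℚ] K) ∨ Nonempty ((K ≃ₐ[ℚ] K) ≃* QuaternionGroup (2 ^ (n - 2)))) (Φ : CMType K) :
    IsNondegenerate Φ := by
  rcases h with hcyc | hq
  · exact CyclicTwoPower.isNondegenerate_of_isCyclic hcyc (k := n - 1) (by rw [hdeg, Nat.sub_add_cancel hn]) Φ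
  · obtain ⟨e⟩ := hq
    haveI : NeZero (2 ^ (n - 2)) := ⟨by positivity⟩
    exact GaloisDicyclic.isNondegenerate_quaternion (k := n - 2) rfl e Φ

/-- **THE CLASSIFICATION OF MINIMAL GALOIS CM FIELDS OF `2`-POWER DEGREE `≥ 64`.**  `K` Galois CM, `[K:ℚ] = 2^n`, `n ≥ 6`, complex
conjugation the only central involution of `Gal(K/ℚ)`.  Then: every primitive CM type of `K` is nondegenerate (the Hodge ring of
every power of every SIMPLE abelian variety with CM by `K` is generated by divisor classes) **if and only if** `Gal(K/ℚ)` is cyclic or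
generalised quaternion. [cite: Rotman1995, Thm. 5.46] [cite: Kubota1965, §4 Lemma 2] [cite: Shimura1998, §8.2 Prop. 26] -/
theorem forall_isPrimitive_isNondegenerate_iff_isCyclic_or_quaternion {n : ℕ} (hdeg : Module.finrank ℚ K = 2 ^ n) (hn : 6 ≤ n)
    (hmin : ∀ σ : K ≃ₐ[ℚ] K, σ * σ = 1 → σ ≠ 1 → (∀ τ : K ≃ₐ[ℚ] K, τ * σ = σ * τ) →
      σ = (IsCMField.complexConj K).restrictScalars ℚ) :
    (∀ (Φ : CMType K) (φ : K →+* ℂ), IsPrimitive (ℂ ≃+* ℂ) Φ.1 φ → IsNondegenerate Φ) ↔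
      (IsCyclic (K ≃ₐ[ℚ] K) ∨ Nonempty ((K ≃ₐ[ℚ] K) ≃* QuaternionGroup (2 ^ (n - 2)))) :=
  ⟨fun hgood => isCyclic_or_quaternion_of_forall_isNondegenerate hdeg hn hmin hgood,
    fun h Φ _ _ => isNondegenerate_of_isCyclic_or_quaternion hdeg (by omega) h Φ⟩

/-- **GOOD ⟹ ALL TYPES** for minimal Galois CM fields of `2`-power degree `≥ 64`: if every PRIMITIVE CM type is nondegenerate then
EVERY CM type is nondegenerate (through the classification). [cite: Kubota1965, §4 Lemma 2] -/
theorem isNondegenerate_of_forall_isPrimitive_isNondegenerate {n : ℕ} (hdeg : Module.finrank ℚ K = 2 ^ n) (hn : 6 ≤ n)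
    (hmin : ∀ σ : K ≃ₐ[ℚ] K, σ * σ = 1 → σ ≠ 1 → (∀ τ : K ≃ₐ[ℚ] K, τ * σ = σ * τ) →
      σ = (IsCMField.complexConj K).restrictScalars ℚ)
    (hgood : ∀ (Φ : CMType K) (φ : K →+* ℂ), IsPrimitive (ℂ ≃+* ℂ) Φ.1 φ → IsNondegenerate Φ) (Φ : CMType K) :
    IsNondegenerate Φ :=
  isNondegenerate_of_isCyclic_or_quaternion hdeg (by omega) (isCyclic_or_quaternion_of_forall_isNondegenerate hdeg hn hmin hgood) Φ

/-- **… hence the HODGE CONJECTURE for every power of EVERY abelian variety with CM by such a field** (any CM type, any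
realisation), unconditionally. [cite: Gordon1999HodgeAVSurvey, Thm. 6.4 and §9.3] -/
theorem hodgeConjectureFor_pow_of_forall_isPrimitive_isNondegenerate {n : ℕ} (hdeg : Module.finrank ℚ K = 2 ^ n) (hn : 6 ≤ n)
    (hmin : ∀ σ : K ≃ₐ[ℚ] K, σ * σ = 1 → σ ≠ 1 → (∀ τ : K ≃ₐ[ℚ] K, τ * σ = σ * τ) →
      σ = (IsCMField.complexConj K).restrictScalars ℚ)
    (hgood : ∀ (Φ : CMType K) (φ : K →+* ℂ), IsPrimitive (ℂ ≃+* ℂ) Φ.1 φ → IsNondegenerate Φ)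
    {Φ : CMType K} {A : AbelianVariety ℂ} {ι : 𝓞 K →+* End A} {θ : K →+* Module.End ℂ (complexBetti A.X 1)}
    (hA : IsCMTypeRealisation Φ A ι θ) (N : ℕ) :
    HodgeConjectureFor (⨁ fun _ : Fin N => A).dim (⨁ fun _ : Fin N => A).X :=
  (isNondegenerate_of_forall_isPrimitive_isNondegenerate hdeg hn hmin hgood Φ).hodgeConjectureFor_pow hA N

/-! ## §3 Minimality as «every normal subgroup `≠ 1` contains complex conjugation» -/

/-- If every normal subgroup `N ≠ 1` of `Gal(K/ℚ)` contains complex conjugation (i.e. `K` has NO proper Galois CM subfield: every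
proper subfield of `K` Galois over `ℚ` is totally real), then complex conjugation is the only central involution of `Gal(K/ℚ)`.
[cite: Shimura1998, §18.2] -/
theorem eq_complexConj_of_central_involution_of_minimal
    (hmin : ∀ N : Subgroup (K ≃ₐ[ℚ] K), N.Normal → N ≠ ⊥ → (IsCMField.complexConj K).restrictScalars ℚ ∈ N)
    (σ : K ≃ₐ[ℚ] K) (hσ : σ * σ = 1) (hσ1 : σ ≠ 1) (hcen : ∀ τ : K ≃ₐ[ℚ] K, τ * σ = σ * τ) :
    σ = (IsCMField.complexConj K).restrictScalars ℚ := by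
  set N := Subgroup.zpowers σ with hN
  haveI : N.Normal := by
    refine ⟨fun x hx g => ?_⟩
    rw [hN, Subgroup.mem_zpowers_iff] at hx
    obtain ⟨i, rfl⟩ := hx
    have hc : g * σ ^ i = σ ^ i * g := ((show Commute g σ from hcen g).zpow_right i).eq
    rw [hc, mul_inv_cancel_right]
    exact Subgroup.zpow_mem _ (Subgroup.mem_zpowers σ) i
  have hNbot : N ≠ ⊥ := fun h => hσ1 (by
    have : σ ∈ N := Subgroup.mem_zpowers σ
    rw [h] at this
    exact Subgroup.mem_bot.1 this)
  have hc := hmin N inferInstance hNbot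
  rw [hN, Subgroup.mem_zpowers_iff] at hc
  obtain ⟨i, hi⟩ := hc
  -- `σ ^ i ∈ {1, σ}`
  have hσ2 : σ ^ (2 : ℤ) = 1 := by rw [zpow_two, hσ]
  obtain ⟨j, hj | hj⟩ := Int.even_or_odd' i
  · exfalso
    have h1 : σ ^ i = 1 := by rw [hj, zpow_mul, hσ2, one_zpow]
    exact model_complexConj_ne_one (MulEquiv.refl (K ≃ₐ[ℚ] K)) (by simp) (hi.symm.trans h1)
  · rw [hj, zpow_add, zpow_mul, hσ2, one_zpow, one_mul, zpow_one] at hi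
    exact hi

/-- **THE CLASSIFICATION, minimality via normal subgroups**: `K` Galois CM, `[K:ℚ] = 2^n`, `n ≥ 6`, every normal subgroup `≠ 1`
of `Gal(K/ℚ)` containing complex conjugation (no proper Galois CM subfield).  Then every primitive CM type of `K` is nondegenerate
iff `Gal(K/ℚ)` is cyclic or generalised quaternion. [cite: Rotman1995, Thm. 5.46] [cite: Kubota1965, §4 Lemma 2]
[cite: Shimura1998, §8.2 Prop. 26] -/
theorem forall_isPrimitive_isNondegenerate_iff_of_minimal {n : ℕ} (hdeg : Module.finrank ℚ K = 2 ^ n) (hn : 6 ≤ n)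
    (hmin : ∀ N : Subgroup (K ≃ₐ[ℚ] K), N.Normal → N ≠ ⊥ → (IsCMField.complexConj K).restrictScalars ℚ ∈ N) :
    (∀ (Φ : CMType K) (φ : K →+* ℂ), IsPrimitive (ℂ ≃+* ℂ) Φ.1 φ → IsNondegenerate Φ) ↔
      (IsCyclic (K ≃ₐ[ℚ] K) ∨ Nonempty ((K ≃ₐ[ℚ] K) ≃* QuaternionGroup (2 ^ (n - 2)))) :=
  forall_isPrimitive_isNondegenerate_iff_isCyclic_or_quaternion hdeg hn
    fun σ hσ hσ1 hcen => eq_complexConj_of_central_involution_of_minimal hmin σ hσ hσ1 hcen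

/-- **GOOD minimal Galois CM fields of `2`-power degree `≥ 64`: the Hodge conjecture for every power of every abelian variety with
CM by `K`** (minimality via normal subgroups). [cite: Gordon1999HodgeAVSurvey, Thm. 6.4 and §9.3] -/
theorem hodgeConjectureFor_pow_of_forall_isPrimitive_isNondegenerate_of_minimal {n : ℕ}
    (hdeg : Module.finrank ℚ K = 2 ^ n) (hn : 6 ≤ n)
    (hmin : ∀ N : Subgroup (K ≃ₐ[ℚ] K), N.Normal → N ≠ ⊥ → (IsCMField.complexConj K).restrictScalars ℚ ∈ N)
    (hgood : ∀ (Φ : CMType K) (φ : K →+* ℂ), IsPrimitive (ℂ ≃+* ℂ) Φ.1 φ → IsNondegenerate Φ)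
    {Φ : CMType K} {A : AbelianVariety ℂ} {ι : 𝓞 K →+* End A} {θ : K →+* Module.End ℂ (complexBetti A.X 1)}
    (hA : IsCMTypeRealisation Φ A ι θ) (N : ℕ) :
    HodgeConjectureFor (⨁ fun _ : Fin N => A).dim (⨁ fun _ : Fin N => A).X :=
  hodgeConjectureFor_pow_of_forall_isPrimitive_isNondegenerate hdeg hn
    (fun σ hσ hσ1 hcen => eq_complexConj_of_central_involution_of_minimal hmin σ hσ hσ1 hcen) hgood hA N

/-- If the CENTRE of `Gal(K/ℚ)` is cyclic, complex conjugation is its only central involution (a cyclic group has at most one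
involution: `#{a | a² = 1} ≤ 2`). [folklore] -/
theorem eq_complexConj_of_central_involution_of_isCyclic_center (hZ : IsCyclic (Subgroup.center (K ≃ₐ[ℚ] K)))
    (σ : K ≃ₐ[ℚ] K) (hσ : σ * σ = 1) (hσ1 : σ ≠ 1) (hcen : ∀ τ : K ≃ₐ[ℚ] K, τ * σ = σ * τ) :
    σ = (IsCMField.complexConj K).restrictScalars ℚ := by
  classical
  by_contra hne
  set c := (IsCMField.complexConj K).restrictScalars ℚ with hc
  have hcZ : c ∈ Subgroup.center (K ≃ₐ[ℚ] K) :=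
    Subgroup.mem_center_iff.2 fun τ => (model_complexConj_comm (MulEquiv.refl (K ≃ₐ[ℚ] K)) (by simp [hc]) τ).symm
  have hσZ : σ ∈ Subgroup.center (K ≃ₐ[ℚ] K) := Subgroup.mem_center_iff.2 fun τ => hcen τ
  have hcc : c * c = 1 := model_complexConj_mul_self (MulEquiv.refl (K ≃ₐ[ℚ] K)) (by simp [hc])
  have hc1 : c ≠ 1 := model_complexConj_ne_one (MulEquiv.refl (K ≃ₐ[ℚ] K)) (by simp [hc])
  haveI := hZ
  have hle := IsCyclic.card_pow_eq_one_le (α := Subgroup.center (K ≃ₐ[ℚ] K)) (n := 2) (by norm_num)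
  have hsub : ({1, ⟨σ, hσZ⟩, ⟨c, hcZ⟩} : Finset (Subgroup.center (K ≃ₐ[ℚ] K))) ⊆
      Finset.univ.filter (fun a : Subgroup.center (K ≃ₐ[ℚ] K) => a ^ 2 = 1) := by
    intro a ha
    simp only [Finset.mem_insert, Finset.mem_singleton] at ha
    simp only [Finset.mem_filter, Finset.mem_univ, true_and]
    rcases ha with rfl | rfl | rfl
    · exact one_pow 2
    · exact Subtype.ext (by simpa [pow_two] using hσ)
    · exact Subtype.ext (by simpa [pow_two] using hcc)
  have hcard3 : ({1, ⟨σ, hσZ⟩, ⟨c, hcZ⟩} : Finset (Subgroup.center (K ≃ₐ[ℚ] K))).card = 3 := by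
    rw [Finset.card_insert_of_notMem, Finset.card_pair]
    · exact fun h => hne (congrArg Subtype.val h)
    · simp only [Finset.mem_insert, Finset.mem_singleton, not_or]
      exact ⟨fun h => hσ1 (congrArg Subtype.val h).symm, fun h => hc1 (congrArg Subtype.val h).symm⟩
  have := Finset.card_le_card hsub
  rw [hcard3] at this
  omega

/-- **THE CLASSIFICATION for Galois groups with CYCLIC CENTRE**: `K` Galois CM, `[K:ℚ] = 2^n`, `n ≥ 6`, `Z(Gal(K/ℚ))` cyclic.  Then
every primitive CM type of `K` is nondegenerate iff `Gal(K/ℚ)` is cyclic or generalised quaternion.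
[cite: Rotman1995, Thm. 5.46] [cite: Kubota1965, §4 Lemma 2] [cite: Shimura1998, §8.2 Prop. 26] -/
theorem forall_isPrimitive_isNondegenerate_iff_of_isCyclic_center {n : ℕ} (hdeg : Module.finrank ℚ K = 2 ^ n) (hn : 6 ≤ n)
    (hZ : IsCyclic (Subgroup.center (K ≃ₐ[ℚ] K))) :
    (∀ (Φ : CMType K) (φ : K →+* ℂ), IsPrimitive (ℂ ≃+* ℂ) Φ.1 φ → IsNondegenerate Φ) ↔
      (IsCyclic (K ≃ₐ[ℚ] K) ∨ Nonempty ((K ≃ₐ[ℚ] K) ≃* QuaternionGroup (2 ^ (n - 2)))) :=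
  forall_isPrimitive_isNondegenerate_iff_isCyclic_or_quaternion hdeg hn
    fun σ hσ hσ1 hcen => eq_complexConj_of_central_involution_of_isCyclic_center hZ σ hσ hσ1 hcen

/-- **Minimality in field terms.**  If every PROPER intermediate field of `K/ℚ` that is normal over `ℚ` is totally real (fixed
pointwise by complex conjugation) — i.e. `K` has NO PROPER GALOIS CM SUBFIELD — then every normal subgroup `N ≠ 1` of `Gal(K/ℚ)`
contains complex conjugation (apply the hypothesis to the fixed field of `N`). [cite: Shimura1998, §18.2] -/
theorem complexConj_mem_of_normal_of_forall_intermediateField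
    (hminF : ∀ L : IntermediateField ℚ K, L ≠ ⊤ → Normal ℚ L → ∀ x : K, x ∈ L → IsCMField.complexConj K x = x)
    (N : Subgroup (K ≃ₐ[ℚ] K)) [N.Normal] (hN : N ≠ ⊥) : (IsCMField.complexConj K).restrictScalars ℚ ∈ N := by
  have hL : IntermediateField.fixedField N ≠ ⊤ := by
    intro h
    apply hN
    rw [← IntermediateField.fixingSubgroup_fixedField N, h, IntermediateField.fixingSubgroup_top]
  haveI : IsGalois ℚ (IntermediateField.fixedField N) := IsGalois.of_fixedField_normal_subgroup N
  have hfix := hminF (IntermediateField.fixedField N) hL inferInstance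
  rw [← IntermediateField.fixingSubgroup_fixedField N, IntermediateField.mem_fixingSubgroup_iff]
  intro x hx
  rw [AlgEquiv.restrictScalars_apply]
  exact hfix x hx

/-- **THE CLASSIFICATION, field form**: `K` Galois CM of degree `2^n ≥ 64` WITHOUT PROPER GALOIS CM SUBFIELD (every proper subfield
of `K` normal over `ℚ` is totally real).  Then every primitive CM type of `K` is nondegenerate **iff** `Gal(K/ℚ)` is cyclic or
generalised quaternion; in that case every CM type is nondegenerate and the Hodge conjecture holds for all powers of all abelian
varieties with CM by `K` (`hodgeConjectureFor_pow_of_forall_isPrimitive_isNondegenerate_of_minimal`).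
[cite: Rotman1995, Thm. 5.46] [cite: Kubota1965, §4 Lemma 2] [cite: Shimura1998, §8.2 Prop. 26 and §18.2] -/
theorem forall_isPrimitive_isNondegenerate_iff_of_forall_intermediateField {n : ℕ} (hdeg : Module.finrank ℚ K = 2 ^ n)
    (hn : 6 ≤ n)
    (hminF : ∀ L : IntermediateField ℚ K, L ≠ ⊤ → Normal ℚ L → ∀ x : K, x ∈ L → IsCMField.complexConj K x = x) :
    (∀ (Φ : CMType K) (φ : K →+* ℂ), IsPrimitive (ℂ ≃+* ℂ) Φ.1 φ → IsNondegenerate Φ) ↔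
      (IsCyclic (K ≃ₐ[ℚ] K) ∨ Nonempty ((K ≃ₐ[ℚ] K) ≃* QuaternionGroup (2 ^ (n - 2)))) :=
  forall_isPrimitive_isNondegenerate_iff_of_minimal hdeg hn
    fun N hNn hN => @complexConj_mem_of_normal_of_forall_intermediateField K _ _ _ _ hminF N hNn hN

/-! ## §4 Minimal GOOD fields: odd primes do not divide the degree -/

/-- In a MINIMAL Galois CM field no element `σ ≠ 1` of ODD prime order `p` of the Galois group can generate a normal subgroup: `⟨σ⟩`
would be a normal subgroup `≠ 1` not containing complex conjugation (which has order `2 ∤ p`). [cite: Shimura1998, §18.2] -/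
theorem false_of_minimal_of_conj_mem_zpowers {p : ℕ} [hp : Fact p.Prime] (hp2 : p ≠ 2)
    (hmin : ∀ N : Subgroup (K ≃ₐ[ℚ] K), N.Normal → N ≠ ⊥ → (IsCMField.complexConj K).restrictScalars ℚ ∈ N)
    (σ : K ≃ₐ[ℚ] K) (hσ : orderOf σ = p) (hnorm : ∀ τ : K ≃ₐ[ℚ] K, ∃ k : ℕ, τ * σ * τ⁻¹ = σ ^ k) : False := by
  classical
  set N := Subgroup.zpowers σ with hN
  haveI : N.Normal := by
    refine ⟨fun x hx τ => ?_⟩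
    rw [hN, Subgroup.mem_zpowers_iff] at hx
    obtain ⟨i, rfl⟩ := hx
    obtain ⟨k, hk⟩ := hnorm τ
    rw [show τ * σ ^ i * τ⁻¹ = (τ * σ * τ⁻¹) ^ i by rw [← MulAut.conj_apply, map_zpow, MulAut.conj_apply], hk]
    exact N.zpow_mem (N.pow_mem (Subgroup.mem_zpowers σ) k) i
  have hσ1 : σ ≠ 1 := by
    intro h
    rw [h, orderOf_one] at hσ
    exact hp.out.one_lt.ne hσ
  have hNbot : N ≠ ⊥ := fun h => hσ1 (by
    have : σ ∈ N := Subgroup.mem_zpowers σ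
    rw [h] at this
    exact Subgroup.mem_bot.1 this)
  have hc := hmin N inferInstance hNbot
  have hc2 : orderOf ((IsCMField.complexConj K).restrictScalars ℚ) = 2 :=
    orderOf_eq_prime (by rw [pow_two]; exact model_complexConj_mul_self (MulEquiv.refl (K ≃ₐ[ℚ] K)) (by simp))
      (model_complexConj_ne_one (MulEquiv.refl (K ≃ₐ[ℚ] K)) (by simp))
  have hdvd := orderOf_dvd_of_mem_zpowers hc
  rw [hc2, hσ] at hdvd
  exact hp2 ((Nat.prime_dvd_prime_iff_eq Nat.prime_two hp.out).1 hdvd).symm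

/-- **GOOD minimal Galois CM fields: an odd prime `p` with `[K:ℚ] = 2pn`, `16 ≤ n`, `8p ≤ 2^(n/4)` cannot divide the degree.**
(An element of order `p` generates a subgroup that is normal by GOODness — gen 33 `exists_conj_eq_pow_of_forall_isNondegenerate` —
contradicting minimality.) [cite: Shimura1998, §8.2 Prop. 26 and §18.2] -/
theorem false_of_minimal_of_forall_isNondegenerate_of_prime (p n : ℕ) [hp : Fact p.Prime] (hp2 : p ≠ 2)
    (hdeg : Module.finrank ℚ K = 2 * p * n) (hn : 16 ≤ n) (hpn : 8 * p ≤ 2 ^ (n / 4))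
    (hmin : ∀ N : Subgroup (K ≃ₐ[ℚ] K), N.Normal → N ≠ ⊥ → (IsCMField.complexConj K).restrictScalars ℚ ∈ N)
    (hgood : ∀ (Φ : CMType K) (φ : K →+* ℂ), IsPrimitive (ℂ ≃+* ℂ) Φ.1 φ → IsNondegenerate Φ) : False := by
  classical
  have hcard : Fintype.card (K ≃ₐ[ℚ] K) = 2 * p * n := by
    rw [card_model_eq_finrank (MulEquiv.refl (K ≃ₐ[ℚ] K)), hdeg]
  obtain ⟨σ, hσ⟩ := exists_prime_orderOf_dvd_card p (by rw [hcard]; exact ⟨2 * n, by ring⟩)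
  have hσp : σ ^ p = 1 := by rw [← hσ, pow_orderOf_eq_one]
  have hσ1 : σ ≠ 1 := by
    intro h
    rw [h, orderOf_one] at hσ
    exact hp.out.one_lt.ne hσ
  exact false_of_minimal_of_conj_mem_zpowers hp2 hmin σ hσ fun τ => by
    obtain ⟨k, -, hk⟩ := exists_conj_eq_pow_of_forall_isNondegenerate p n hdeg hn hpn hgood σ hσp hσ1 τ
    exact ⟨k, hk⟩

/-- **… in particular `3 ∤ [K:ℚ]` for a GOOD minimal Galois CM field of degree `≥ 84`.** [cite: Shimura1998, §8.2 Prop. 26 and §18.2] -/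
theorem not_three_dvd_finrank_of_minimal_of_forall_isNondegenerate (hdeg : 84 ≤ Module.finrank ℚ K)
    (hmin : ∀ N : Subgroup (K ≃ₐ[ℚ] K), N.Normal → N ≠ ⊥ → (IsCMField.complexConj K).restrictScalars ℚ ∈ N)
    (hgood : ∀ (Φ : CMType K) (φ : K →+* ℂ), IsPrimitive (ℂ ≃+* ℂ) Φ.1 φ → IsNondegenerate Φ) :
    ¬ 3 ∣ Module.finrank ℚ K := by
  classical
  intro h3
  haveI : Fact (Nat.Prime 3) := ⟨Nat.prime_three⟩
  obtain ⟨σ, hσ⟩ := exists_prime_orderOf_dvd_card (G := K ≃ₐ[ℚ] K) 3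
    (by rw [card_model_eq_finrank (MulEquiv.refl (K ≃ₐ[ℚ] K))]; exact h3)
  have hσp : σ ^ 3 = 1 := by rw [← hσ, pow_orderOf_eq_one]
  have hσ1 : σ ≠ 1 := by
    intro h
    rw [h, orderOf_one] at hσ
    norm_num at hσ
  exact false_of_minimal_of_conj_mem_zpowers (by norm_num) hmin σ hσ fun τ => by
    obtain ⟨k, -, hk⟩ := exists_conj_eq_pow_three_of_forall_isNondegenerate hdeg hgood σ hσp hσ1 τ
    exact ⟨k, hk⟩

/-- **LARGE GOOD MINIMAL GALOIS CM FIELDS HAVE `2`-POWER DEGREE AND CYCLIC OR GENERALISED QUATERNION GALOIS GROUP.**  `K` minimal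
Galois CM (every normal subgroup `≠ 1` of `Gal(K/ℚ)` contains complex conjugation), `[K:ℚ] ≥ 64`, and every odd prime `p ∣ [K:ℚ]`
in the range of the uniform skew-section count (`[K:ℚ] = 2pn`, `16 ≤ n`, `8p ≤ 2^(n/4)`).  If every primitive CM type of `K` is
nondegenerate, then `[K:ℚ] = 2^n` and `Gal(K/ℚ)` is cyclic or `≃ QuaternionGroup (2^(n-2))`.
[cite: Rotman1995, Thm. 5.46] [cite: Shimura1998, §8.2 Prop. 26 and §18.2] -/
theorem exists_finrank_eq_two_pow_and_isCyclic_or_quaternion_of_minimal (hdeg : 64 ≤ Module.finrank ℚ K)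
    (hodd : ∀ p : ℕ, p.Prime → p ≠ 2 → p ∣ Module.finrank ℚ K →
      ∃ n : ℕ, Module.finrank ℚ K = 2 * p * n ∧ 16 ≤ n ∧ 8 * p ≤ 2 ^ (n / 4))
    (hmin : ∀ N : Subgroup (K ≃ₐ[ℚ] K), N.Normal → N ≠ ⊥ → (IsCMField.complexConj K).restrictScalars ℚ ∈ N)
    (hgood : ∀ (Φ : CMType K) (φ : K →+* ℂ), IsPrimitive (ℂ ≃+* ℂ) Φ.1 φ → IsNondegenerate Φ) :
    ∃ n : ℕ, Module.finrank ℚ K = 2 ^ n ∧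
      (IsCyclic (K ≃ₐ[ℚ] K) ∨ Nonempty ((K ≃ₐ[ℚ] K) ≃* QuaternionGroup (2 ^ (n - 2)))) := by
  classical
  set d := Module.finrank ℚ K with hd
  have hd0 : d ≠ 0 := by omega
  have h2pow : d = 2 ^ d.primeFactorsList.length := by
    refine Nat.eq_prime_pow_of_unique_prime_dvd hd0 fun {q} hq hqd => ?_
    by_contra hq2
    obtain ⟨n, hdn, hn, hpn⟩ := hodd q hq hq2 hqd
    haveI : Fact q.Prime := ⟨hq⟩
    exact false_of_minimal_of_forall_isNondegenerate_of_prime q n hq2 hdn hn hpn hmin hgood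
  refine ⟨d.primeFactorsList.length, h2pow, ?_⟩
  have hn6 : 6 ≤ d.primeFactorsList.length := by
    by_contra h
    push Not at h
    have : 2 ^ d.primeFactorsList.length ≤ 2 ^ 5 := Nat.pow_le_pow_right (by norm_num) (by omega)
    omega
  exact (forall_isPrimitive_isNondegenerate_iff_of_minimal h2pow hn6 hmin).1 hgood

end Summit.HodgeConjecture.CorCM.GaloisModels
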